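import Summits.QuantumFields.YangMills.Theorems.UnitScaleTiltProp7CoerciveOfInverseBound
import Summits.QuantumFields.YangMills.Theorems.UnitScaleTiltProp7DeltaEtaAlmostPositive
import Summits.QuantumFields.YangMills.Theorems.UnitScaleTiltProp7SectET3WilsonHessianT3RealityRows
import HarnessLib

/-!
# Route `UnitScaleTilt`, crux K1 «MinimiserStabilityRegPr» (stmt-QuantumFields-19200) — route-R E′ (A′), RULING g28-№13 (2) as refined by ACK 91 (3) and ★★OWNER 02:02Z «YES»:
# **THE QUANTITATIVE COERCIVITY ROW OF `Δ_a(U₀) = Δ^η + D R_S D* + Q_k† a Q_k` FOLLOWS FROM THE `norm_G₀` ROW ALONE** on the printed-regular class —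
# `B₀⁻¹·‖y‖² ≤ re⟪y, Δ_a(U₀) y⟫` for all `y`, from a right inverse `G₀` with `‖G₀ f‖ ≤ B₀‖f‖` (★p1 g17 WORD 14's letter), `RegPr F n K ε₀ U₀` and the window `1029·ε₀·B₀ < 1`

Cell `ym3-torus`, width seat `ym-ust-19200-w4` (gen 8); the END-TO-END composition of this seat's T1 (✓`Prop7CoerciveOfInverseBound`, p688334∕p688615) and T2 (✓`Prop7DeltaPrimeL2Bound` p689446,
✓`Prop7DeltaEtaAlmostPositive` p689838) with the lane's Hermitian row ✓`Prop7SectET3WilsonHessian.DeltaEta_isSymmetric`.  THEOREMS ONLY (0 `def`, 0 `sorry`); `--supports stmt-QuantumFields-19200`,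
count-neutral.  YM₃ on T³ is a ladder rung (R3), not the Clay problem; nothing here claims [Balaban1985BackgroundPropagators] Thm 3.3 (the `norm_G₀` row is a HYPOTHESIS — the ONE displayed
N06 input of the (A′) growth side), HESS at `IsCritR2`, `hcoW`, E′, EX, the crux, d = 4 or the mass gap.

WHAT IS PROVED (ns `…Theorems.Prop7CoerciveOfNormG0`, slot `Δx := DeltaEtaSlot F n K c₀` = print's `Δ^η(U₀)`, so `laplaceA … (DeltaEtaSlot …) U₀` IS print's `Δ_a(U₀)` of (3.26) and `G₀` its `G`
of (3.27)): ★ `DeltaEtaSlot_isSymmetric`; ★★★ `coercive_laplaceA_DeltaEta_of_normG₀` (right-inverse letter), ★★★ `coercive_laplaceA_DeltaEta_of_inv_bound` (inverse-free letter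
«`‖f‖ ≤ B₀‖Δ_a f‖`»), ★★ `pos_laplaceA_DeltaEta_of_normG₀` (the EX display's `hPosΔ` shape at slot `Δ^η`: `x ≠ 0 → 0 < re⟪x, Δ_a x⟫`), ★★ `hess_DeltaEta_of_normG₀_of_isLandauPrintS_of_ker`
(the K-only Hessian on print's slice ∩ `ker Q_k`: `B₀⁻¹‖X̃‖² ≤ re⟪X̃, Δ^η X̃⟫`, ∘ ✓p686677).  HONEST SCOPE: composition; constants crude (`1029`); nothing of Thm 3.3∕3.11 at curved `U₀` claimed;
rung R3, not Clay; YM gap NOT proved.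

References: T. Bałaban, CMP 99 (1985) 389–434 [Balaban1985BackgroundPropagators] ((3.10)–(3.12) p.392, (3.26)–(3.27) p.395, Thm 3.3 p.399, Thm 3.11 p.416); CMP 102 (1985) 277–309
[Balaban1985Variational] ((14) p.280, (141)–(142) p.299).
-/

set_option autoImplicit false

noncomputable section

open scoped InnerProductSpace ComplexConjugate BigOperators

namespace Summit.QuantumFields.YangMills.Theorems.Prop7CoerciveOfNormG0

open Literature.MathematicalPhysics.QuantumFieldTheory.Balaban1983to89
open Literature.MathematicalPhysics.QuantumFieldTheory.Balaban1983to89.T3ContinuumYM3Torus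
open Literature.MathematicalPhysics.QuantumFieldTheory.Balaban1983to89.T3PrintedRegularMinimiser (RegPr)
open B11Eq103H1Complex (BondL2K)
open Summit.QuantumFields.YangMills.Theorems.Prop7SectET3Transport (periodsT3)
open Summit.QuantumFields.YangMills.Theorems.Prop7SectET3HilbertLetters (W₂ toL2)
open Summit.QuantumFields.YangMills.Theorems.Prop7SectET3CurvedPropagators (Qk laplaceA)
open Summit.QuantumFields.YangMills.Theorems.Prop7SectET3WilsonHessian (DeltaEta DeltaEtaSlot DeltaEta_isSymmetric)
open Summit.QuantumFields.YangMills.Theorems.Prop7SPrint (IsLandauPrintS)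
open Summit.QuantumFields.YangMills.Theorems.Prop7CoerciveOfInverseBound (coercive_laplaceA_of_almostPos_of_inverse_bound coercive_laplaceA_of_almostPos_of_inv_bound
  pos_laplaceA_of_almostPos_of_inverse_bound hess_of_almostPos_of_inverse_bound_of_isLandauPrintS_of_ker)
open Summit.QuantumFields.YangMills.Theorems.Prop7DeltaEtaAlmostPositive (almostPos_DeltaEtaSlot_of_regPr)

variable (F : T3Family) (n K : ℕ) (h : n ≤ K) (c₀ cB a : ℝ) [Fact (0 < c₀)] [Fact (0 < cB)]

omit [Fact (0 < cB)] in
/-- ★ The Hessian letter of record is symmetric: `(DeltaEtaSlot U₀).IsSymmetric` (= ✓`DeltaEta_isSymmetric`, print's «hermitian operator», (3.10)). [cite: Balaban1985BackgroundPropagators, (3.10)–(3.12) p.392] -/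
theorem DeltaEtaSlot_isSymmetric (U₀ : GaugeField (F.P K) 0 (Matrix.specialUnitaryGroup (Fin 2) ℂ)) :
    (DeltaEtaSlot F n K c₀ U₀).IsSymmetric :=
  DeltaEta_isSymmetric (F := F) (n := n) (K := K) (c₀ := c₀) U₀

/-- ★★★ **(COERC) FROM `norm_G₀` ALONE — RIGHT-INVERSE LETTER** (★p1 g17 WORD 14): on `RegPr F n K ε₀ U₀` (`0 ≤ ε₀`), a right inverse `G₀` of
`Δ_a(U₀) = Δ^η(U₀) + D R_S D* + Q_k† a Q_k` (`0 ≤ a`) with `‖G₀ f‖ ≤ B₀‖f‖` and the window `1029·ε₀·B₀ < 1` give `B₀⁻¹·‖y‖² ≤ re⟪y, Δ_a(U₀) y⟫` for every `y` — [Balaban1985BackgroundPropagators]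
Thm 3.11 for `Δ_a` from Thm 3.3's `L²` bound for `G = Δ_a⁻¹`, with `γ := 1∕B₀` BY NAME. [cite: Balaban1985BackgroundPropagators, Thm 3.11 p.416, Thm 3.3 p.399, (3.26)–(3.27) p.395, (3.10) p.392] -/
theorem coercive_laplaceA_DeltaEta_of_normG₀ {ε₀ : ℝ} (hε₀ : 0 ≤ ε₀) (U₀ : GaugeField (F.P K) 0 (Matrix.specialUnitaryGroup (Fin 2) ℂ)) (hreg : RegPr F n K ε₀ U₀)
    (ha : 0 ≤ a) {B₀ : ℝ} (hB₀ : 0 < B₀) (hwin : 1029 * ε₀ * B₀ < 1)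
    (G₀ : BondL2K ℂ 3 (periodsT3 F K) c₀ W₂ →ₗ[ℂ] BondL2K ℂ 3 (periodsT3 F K) c₀ W₂)
    (hG : laplaceA F n K h c₀ cB a (DeltaEtaSlot F n K c₀) U₀ ∘ₗ G₀ = LinearMap.id) (hGB : ∀ f, ‖G₀ f‖ ≤ B₀ * ‖f‖)
    (y : BondL2K ℂ 3 (periodsT3 F K) c₀ W₂) :
    B₀⁻¹ * ‖y‖ ^ 2 ≤ RCLike.re ⟪y, laplaceA F n K h c₀ cB a (DeltaEtaSlot F n K c₀) U₀ y⟫_ℂ :=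
  coercive_laplaceA_of_almostPos_of_inverse_bound F n K h c₀ cB a (DeltaEtaSlot F n K c₀) U₀ (DeltaEtaSlot_isSymmetric F n K c₀ U₀) ha hB₀ hwin
    (almostPos_DeltaEtaSlot_of_regPr hε₀ U₀ hreg) G₀ hG hGB y

/-- ★★★ **(COERC) FROM THE INVERSE-FREE LETTER** (px13 g4 THM311-SOCKET): on `RegPr F n K ε₀ U₀` (`0 ≤ ε₀`, `0 ≤ a`), «`∀ f, ‖f‖ ≤ B₀·‖Δ_a(U₀) f‖`» with `1029·ε₀·B₀ < 1` gives
`B₀⁻¹·‖y‖² ≤ re⟪y, Δ_a(U₀) y⟫` for every `y`. [cite: Balaban1985BackgroundPropagators, Thm 3.11 p.416, Thm 3.3 p.399] -/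
theorem coercive_laplaceA_DeltaEta_of_inv_bound {ε₀ : ℝ} (hε₀ : 0 ≤ ε₀) (U₀ : GaugeField (F.P K) 0 (Matrix.specialUnitaryGroup (Fin 2) ℂ)) (hreg : RegPr F n K ε₀ U₀)
    (ha : 0 ≤ a) {B₀ : ℝ} (hB₀ : 0 < B₀) (hwin : 1029 * ε₀ * B₀ < 1)
    (hinv : ∀ f : BondL2K ℂ 3 (periodsT3 F K) c₀ W₂, ‖f‖ ≤ B₀ * ‖laplaceA F n K h c₀ cB a (DeltaEtaSlot F n K c₀) U₀ f‖)
    (y : BondL2K ℂ 3 (periodsT3 F K) c₀ W₂) :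
    B₀⁻¹ * ‖y‖ ^ 2 ≤ RCLike.re ⟪y, laplaceA F n K h c₀ cB a (DeltaEtaSlot F n K c₀) U₀ y⟫_ℂ :=
  coercive_laplaceA_of_almostPos_of_inv_bound F n K h c₀ cB a (DeltaEtaSlot F n K c₀) U₀ (DeltaEtaSlot_isSymmetric F n K c₀ U₀) ha hB₀ hwin
    (almostPos_DeltaEtaSlot_of_regPr hε₀ U₀ hreg) hinv y

/-- ★★ **THE EX DISPLAY'S `hPosΔ` SHAPE AT SLOT `Δ^η` FROM `norm_G₀`**: `0 < re⟪x, Δ_a(U₀) x⟫` for `x ≠ 0`. [cite: Balaban1985BackgroundPropagators, Thm 3.11 p.416] -/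
theorem pos_laplaceA_DeltaEta_of_normG₀ {ε₀ : ℝ} (hε₀ : 0 ≤ ε₀) (U₀ : GaugeField (F.P K) 0 (Matrix.specialUnitaryGroup (Fin 2) ℂ)) (hreg : RegPr F n K ε₀ U₀)
    (ha : 0 ≤ a) {B₀ : ℝ} (hB₀ : 0 < B₀) (hwin : 1029 * ε₀ * B₀ < 1)
    (G₀ : BondL2K ℂ 3 (periodsT3 F K) c₀ W₂ →ₗ[ℂ] BondL2K ℂ 3 (periodsT3 F K) c₀ W₂)
    (hG : laplaceA F n K h c₀ cB a (DeltaEtaSlot F n K c₀) U₀ ∘ₗ G₀ = LinearMap.id) (hGB : ∀ f, ‖G₀ f‖ ≤ B₀ * ‖f‖)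
    (x : BondL2K ℂ 3 (periodsT3 F K) c₀ W₂) (hx : x ≠ 0) :
    0 < RCLike.re ⟪x, laplaceA F n K h c₀ cB a (DeltaEtaSlot F n K c₀) U₀ x⟫_ℂ :=
  pos_laplaceA_of_almostPos_of_inverse_bound F n K h c₀ cB a (DeltaEtaSlot F n K c₀) U₀ (DeltaEtaSlot_isSymmetric F n K c₀ U₀) ha hB₀ hwin
    (almostPos_DeltaEtaSlot_of_regPr hε₀ U₀ hreg) G₀ hG hGB x hx

/-- ★★ **THE K-ONLY HESSIAN ON PRINT'S SLICE ∩ `ker Q_k` FROM `norm_G₀`** ([Balaban1985Variational] p.299 (141)–(142), via ✓p686677): for every route field `X` with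
`IsLandauPrintS U₀ X` and `Q_k(U₀)X̃ = 0`, `B₀⁻¹‖X̃‖² ≤ re⟪X̃, Δ^η(U₀)X̃⟫`. [cite: Balaban1985Variational, (141)–(142) p.299; Balaban1985BackgroundPropagators, Thm 3.11 p.416, Thm 3.3 p.399] -/
theorem hess_DeltaEta_of_normG₀_of_isLandauPrintS_of_ker {ε₀ : ℝ} (hε₀ : 0 ≤ ε₀) (U₀ : GaugeField (F.P K) 0 (Matrix.specialUnitaryGroup (Fin 2) ℂ)) (hreg : RegPr F n K ε₀ U₀)
    (ha : 0 ≤ a) {B₀ : ℝ} (hB₀ : 0 < B₀) (hwin : 1029 * ε₀ * B₀ < 1)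
    (G₀ : BondL2K ℂ 3 (periodsT3 F K) c₀ W₂ →ₗ[ℂ] BondL2K ℂ 3 (periodsT3 F K) c₀ W₂)
    (hG : laplaceA F n K h c₀ cB a (DeltaEtaSlot F n K c₀) U₀ ∘ₗ G₀ = LinearMap.id) (hGB : ∀ f, ‖G₀ f‖ ≤ B₀ * ‖f‖)
    (X : PBond (F.P K) 0 → Matrix (Fin 2) (Fin 2) ℂ) (hX : IsLandauPrintS F n K h c₀ cB U₀ X) (hQ : Qk F n K h c₀ cB U₀ (toL2 F K c₀ X) = 0) :
    B₀⁻¹ * ‖toL2 F K c₀ X‖ ^ 2 ≤ RCLike.re ⟪toL2 F K c₀ X, DeltaEtaSlot F n K c₀ U₀ (toL2 F K c₀ X)⟫_ℂ :=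
  hess_of_almostPos_of_inverse_bound_of_isLandauPrintS_of_ker F n K h c₀ cB a (DeltaEtaSlot F n K c₀) U₀ (DeltaEtaSlot_isSymmetric F n K c₀ U₀) ha hB₀ hwin
    (almostPos_DeltaEtaSlot_of_regPr hε₀ U₀ hreg) G₀ hG hGB X hX hQ

end Summit.QuantumFields.YangMills.Theorems.Prop7CoerciveOfNormG0

end
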